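import Literature.NumberTheory.Automorphic.StrongArtinGL2ArtinSideProofs
import HarnessLib

/-!
# Gelbart's Prop. 4.1 (`π = π(σ)` a.e. ⇒ Frobenius–Satake compatibility everywhere): split into
# Artin's functional equation and the twisted automorphic package of Jacquet–Langlands

Topic `Literature/NumberTheory/Automorphic`. The named fact `frobSatakeCompatibleAt_of_isPiOfArtinRep`
(`StrongArtinGL2.lean`; Gelbart 1997 Prop. 4.1, unramified shadow) hit the literature-prover
budget cap. Its seats PROVED the local rigidity (Jacquet–Langlands 1970, proof of Thm. 12.2,
pp. 210–211), the "quotient of the two functional equations" step (pp. 209–210), the Artin side of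
the global analytic package from Artin's functional equation, and the reduction
`frobSatakeCompatibleAt_of_isPiOfArtinRep_of_artinFE` (`StrongArtinGL2ArtinSideProofs`): the fact
follows from

1. (EXISTING named fact, for every number field) `artin_functional_equation`
   (`ArtinLFunctions.lean`; Neukirch VII (12.6)) — itself already decomposed in the tree
   (`artin_functional_equation_of_brauer_of_rankOne`);
2. (NEW named fact, this file) `JacquetLanglands1970_twistedCuspidalPackage` — the AUTOMORPHIC
   HALF of the global package: for cuspidal `π = π(σ)` on `GL₂(𝔸_F)` with Satake parameter `α` at
   `v`, an idèle class character `ω` with `ω_v = 1`, highly ramified at the other exceptional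
   places (its Galois avatar `χ` trivial on inertia and Frobenius above `v`), such that the
   completed twisted L-functions `Λ(s, ω ⊗ π)`, `Λ(s, ω⁻¹ ⊗ π̃)` are meromorphic with a functional
   equation, entire reciprocal archimedean factors with zeros on finitely many horizontal lines,
   and Euler products agreeing with those of `L(s, σ ⊗ χ)`, `L(s, (σ ⊗ χ)^∨)` off `v`
   (Jacquet–Langlands 1970, Thm. 11.1, Cor. 11.2, Lemma 12.5 and Prop. 3.8, as used on
   pp. 209–211; Gelbart 1997 Prop. 4.1) — displayed verbatim as the hypothesis `H` of the seat's
   reduction.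

`frobSatakeCompatibleAt_of_isPiOfArtinRep_holds_of` PROVES the parent from 1–2. Neither antecedent
restates the parent: 1 is about Artin L-functions only, 2 asserts analytic properties of
automorphic L-functions and says nothing about Frobenius eigenvalues at `v`.

## References

* [JacquetLanglands1970] H. Jacquet, R. P. Langlands, Automorphic Forms on GL(2), LNM 114 (1970),
  Thm. 11.1, Cor. 11.2, Lemma 12.5, proof of Thm. 12.2 (pp. 209–211).
* [Gelbart1997] S. Gelbart, Three lectures on the modularity of `ρ̄_{E,3}` and the Langlands
  reciprocity conjecture, in: Modular Forms and Fermat's Last Theorem (1997), Prop. 4.1.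
* [NeukirchANT1999] J. Neukirch, Algebraic Number Theory, VII §12, Thm. (12.6).
-/

noncomputable section

open scoped MatrixGroups NumberField Polynomial
open NumberField IsDedekindDomain Field Polynomial Complex Filter Topology Set
open Literature.NumberTheory.GaloisRepresentations (ArtinRep FramedArtinRep)
open Literature.NumberTheory.LFunctions

namespace Literature.NumberTheory.Automorphic

section AutomorphicHalf

open scoped Classical

/-- **The twisted cuspidal package (Jacquet–Langlands 1970, Thm. 11.1, Cor. 11.2, Lemma 12.5,
Prop. 3.8, as used in the proof of Thm. 12.2, pp. 209–211; the automorphic half of Gelbart 1997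
Prop. 4.1).** For a number field `F`, a cuspidal automorphic representation `π` of `GL₂(𝔸_F)`
with `π = π(σ)` almost everywhere (`IsPiOfArtinRep σ π`) and a finite place `v` at which `π` has
Satake parameter `α`: there is a continuous character `χ : Γ_F → ℂˣ` trivial on the inertia groups
and on the Frobenius elements above `v` (the Galois avatar of an idèle class character `ω` with
`ω_v = 1`, chosen so ramified at the other exceptional places that all local factors there are
`1`, Lemma 12.5) and functions `Λ_π, Λ_π', Γ_π, Γ_π', ε_π` with: `Λ_π, Λ_π'` meromorphic
(`L(s, ω ⊗ π)`, `L(s, ω⁻¹ ⊗ π̃)` completed, Thm. 11.1 / Cor. 11.2), `Γ_π, Γ_π'` entire with zeros on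
finitely many horizontal lines (reciprocal archimedean factors), `ε_π` continuous and nowhere
zero, a functional equation `Λ_π(s) = ε_π(s) Λ_π'(1 - s)`, and for `re s > c ≥ 1` the Euler-factor
agreements `Λ_π(s) ∏_{a ∈ α}(1 - a q_v^{-s}) Γ_π(s) = L(s, σ ⊗ χ) L_v(σ ⊗ χ, q_v^{-s})` and
`Λ_π'(s) ∏_{a ∈ α}(1 - a⁻¹ q_v^{-s}) Γ_π'(s) = L(s, (σ ⊗ χ)^∨) L_v((σ ⊗ χ)^∨, q_v^{-s})` (local
factors of `ω ⊗ π` and `σ ⊗ χ` agree away from `v`: at unramified places since `π = π(σ)`,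
Prop. 3.8, elsewhere both are `1`). Verbatim the hypothesis `H` of
`frobSatakeCompatibleAt_of_isPiOfArtinRep_of_artinFE`.
[cite: JacquetLanglands1970, Thm. 11.1, Cor. 11.2, Lemma 12.5 and proof of Thm. 12.2 pp. 209–211]
[cite: Gelbart1997, Prop. 4.1] -/
def JacquetLanglands1970_twistedCuspidalPackage : Prop :=
  ∀ {F : Type} [Field F] [NumberField F] (hcpt : isCompact_glFiniteIntegralLevel 2 F)
    (σ : FramedArtinRep F 2) (π : CuspidalAutomorphicRepData 2 F hcpt),
    IsPiOfArtinRep σ π.1 → ∀ (v : HeightOneSpectrum (𝓞 F)) (α : Multiset ℂ),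
      π.1.HasSatakeParamAt v α →
      ∃ (χ : absoluteGaloisGroup F →ₜ* ℂˣ) (Λπ Λπ' Γπ Γπ' επ : ℂ → ℂ) (c : ℝ),
        (∀ 𝔓 ∈ v.primesAbove, ∀ g ∈ 𝔓.inertia (absoluteGaloisGroup F), χ g = 1) ∧
        (∀ 𝔓 ∈ v.primesAbove, ∀ g : absoluteGaloisGroup F,
          IsArithFrobAt (𝓞 F) g 𝔓 → χ g = 1) ∧
        Meromorphic Λπ ∧ Meromorphic Λπ' ∧ Differentiable ℂ Γπ ∧ Differentiable ℂ Γπ' ∧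
        (∃ Y : Set ℝ, Y.Finite ∧ ∀ s, Γπ s = 0 → s.im ∈ Y) ∧
        (∃ Y : Set ℝ, Y.Finite ∧ ∀ s, Γπ' s = 0 → s.im ∈ Y) ∧
        Continuous επ ∧ (∀ s, επ s ≠ 0) ∧ 1 ≤ c ∧
        (∀ s : ℂ, c < s.re →
          Λπ s * ((α.map fun a => eulerTerm v.residueCard a s).prod * Γπ s) =
            GaloisRepresentations.artinLFunction
                (FramedArtinRep.toArtinRep (GaloisRepresentations.FramedRep.twist σ χ)) s *
              ((FramedArtinRep.toArtinRep
                (GaloisRepresentations.FramedRep.twist σ χ)).eulerFactorAt v).eval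
                ((v.residueCard : ℂ) ^ (-s))) ∧
        (∀ s : ℂ, c < s.re →
          Λπ' s * ((α.map fun a => eulerTerm v.residueCard a⁻¹ s).prod * Γπ' s) =
            GaloisRepresentations.artinLFunction
                (FramedArtinRep.toArtinRep (GaloisRepresentations.FramedRep.dual
                  (GaloisRepresentations.FramedRep.twist σ χ))) s *
              ((FramedArtinRep.toArtinRep (GaloisRepresentations.FramedRep.dual
                (GaloisRepresentations.FramedRep.twist σ χ))).eulerFactorAt v).eval
                ((v.residueCard : ℂ) ^ (-s))) ∧
        (∀ s, Λπ s = επ s * Λπ' (1 - s))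

/-- **Assembly: Gelbart's Prop. 4.1 from Artin's functional equation and the twisted cuspidal
package.** `(∀ F, artin_functional_equation) → JacquetLanglands1970_twistedCuspidalPackage →
frobSatakeCompatibleAt_of_isPiOfArtinRep`, by `frobSatakeCompatibleAt_of_isPiOfArtinRep_of_artinFE`
(local rigidity and the quotient of the two functional equations being theorems of the tree).
[cite: Gelbart1997, Prop. 4.1] [cite: JacquetLanglands1970, proof of Thm. 12.2 pp. 209–211] -/
theorem frobSatakeCompatibleAt_of_isPiOfArtinRep_holds_of
    (h₁ : ∀ (F : Type) [Field F] [NumberField F], artin_functional_equation (K := F))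
    (h₂ : JacquetLanglands1970_twistedCuspidalPackage) :
    frobSatakeCompatibleAt_of_isPiOfArtinRep :=
  frobSatakeCompatibleAt_of_isPiOfArtinRep_of_artinFE h₁ h₂

end AutomorphicHalf

end Literature.NumberTheory.Automorphic

end
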